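import Literature.AlgebraicGeometry.Resolution.ArithmeticalThreefolds
import Literature.AlgebraicGeometry.Resolution.InseparableLocalUniformization
import Summits.ResolutionOfSingularities.ResolutionOfSingularities.Theorems.IndSmoothValuativeSmoothingTemkinRegularChart
import Summits.ResolutionOfSingularities.ResolutionOfSingularities.Theorems.IndSmoothValuativeSmoothingSmoothNbhd
import Mathlib.RingTheory.AlgebraicIndependent.Basic
import HarnessLib

/-!
# The crux in transcendence degree `≤ 3`, conditionally on Cossart–Piltant's (LU)
# (crux `IndSmooth.ValuativeSmoothing`, line `birth`, reshape r2, support `smoothFactor_of_trdeg_le_three`)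

Support theorem for crux stmt-ResolutionOfSingularities-16087 (lead reshape r2). CONDITIONAL on
the tree's named fact `Literature.AlgebraicGeometry.Resolution.CossartPiltant2019LU3`
(Cossart–Piltant 2019, Thm. 1.1 in its local-uniformization form (LU) of §4.1, for affine models
of dimension `≤ 3` over a field; taken as the explicit hypothesis `hLU`), it records that the
valuative smoothing statement of the crux holds for finitely generated field extensions `K/k` of
transcendence degree `≤ 3` over a PERFECT field `k`: every finitely generated `k`-subalgebra `R`
of a valuation ring `O ⊇ k` of `K` maps, compatibly with its embedding into `K`, to a smooth
`k`-algebra `T` which itself maps into `O`.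

Proof. Enlarge `R` to an affine model `A ⊇ R` of `O` (`exists_affineModel_ge`); as `A ⊆ K`,
`trdeg_k A ≤ trdeg_k K ≤ 3`, so `dim A ≤ 3` (`ringKrullDim_le_of_trdeg_le`); (LU) refines `A` to
a finitely generated `A' ⊆ O` regular at the centre `𝔪_O ∩ A'`; over the perfect field `k` the
regular centre has a smooth finitely generated neighbourhood `N' ⊇ A'` inside `O`
(`stub_smoothNbhd`). Answer: `T := N'`, `ψ` the inclusion `R ≤ A ≤ A' ≤ N'`, `χ` the embedding
`N' ⊆ K`.

Not here: the unconditional statement (the crux itself), or any case of transcendence degree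
`≥ 4`.
-/

-- single-problem summit: the doubled namespace component is forced
set_option linter.dupNamespace false

namespace Summit.ResolutionOfSingularities.ResolutionOfSingularities.Theorems.ValuativeSmoothing

open Literature.AlgebraicGeometry.Resolution

/-- **Support `smoothFactor_of_trdeg_le_three` (line `birth`, reshape r2, crux
`IndSmooth.ValuativeSmoothing`): the crux in transcendence degree `≤ 3`, conditionally on
Cossart–Piltant.** Assume Cossart–Piltant's local uniformization in dimension `≤ 3`
(`CossartPiltant2019LU3`, hypothesis `hLU`). Let `k` be a perfect field, `K/k` a finitely
generated field extension of transcendence degree `≤ 3`, `O ⊇ k` a valuation ring of `K` and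
`R ⊆ O` a finitely generated `k`-subalgebra of `K`. Then there are a smooth `k`-algebra `T` and
`k`-algebra maps `ψ : R → T`, `χ : T → K` with `χ(T) ⊆ O` and `χ ∘ ψ` the inclusion `R ⊆ K`.
(Refine `R` to an affine model `A` of `O`, of dimension `≤ trdeg_k K ≤ 3`; (LU) gives a finitely
generated `A' ⊇ A` inside `O` regular at the centre, which over a perfect field has a smooth
finitely generated neighbourhood `N' ⊇ A'` inside `O`; take `T := N'`.)
[cite: CossartPiltant2019, Thm. 1.1 with §4.1 (LU)] -/
theorem smoothFactor_of_trdeg_le_three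
    (hLU : Literature.AlgebraicGeometry.Resolution.CossartPiltant2019LU3.{0})
    (k K : Type) [Field k] [PerfectField k] [Field K] [Algebra k K]
    (hK : (⊤ : IntermediateField k K).FG) (hK3 : Algebra.trdeg k K ≤ 3)
    (O : ValuationSubring K) (hO : ∀ c : k, algebraMap k K c ∈ O)
    (R : Subalgebra k K) (hR : R.FG) (hRO : R.toSubring ≤ O.toSubring) :
    ∃ (T : Type) (_ : CommRing T) (_ : Algebra k T), Algebra.Smooth k T ∧
      ∃ (ψ : R →ₐ[k] T) (χ : T →ₐ[k] K), (∀ t : T, χ t ∈ O) ∧ ∀ r : R, χ (ψ r) = (r : K) := by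
  -- an affine model `A ⊇ R` of `O`
  obtain ⟨A, hRA, hAO, hAfg, hAfr⟩ := exists_affineModel_ge k K hK O hO R hR hRO
  -- `dim A ≤ trdeg_k A ≤ trdeg_k K ≤ 3`
  have hA3 : Algebra.trdeg k A ≤ ((3 : ℕ) : Cardinal) := by
    have h := (trdeg_le_of_injective A.val Subtype.val_injective).trans hK3
    exact_mod_cast h
  have hdim : ringKrullDim A ≤ 3 := by
    have h := ringKrullDim_le_of_trdeg_le hA3
    exact_mod_cast h
  -- (LU): a finitely generated refinement `A' ⊇ A` inside `O`, regular at the centre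
  obtain ⟨A', hA'O, hAA', hA'fg, hreg⟩ := hLU k K O A hAO hAfg hAfr hdim
  -- a smooth finitely generated neighbourhood `N' ⊇ A'` of the regular centre inside `O`
  obtain ⟨N', hN'O, -, hN'sm, hA'N'⟩ := stub_smoothNbhd k K O A' hA'O hA'fg hreg
  exact ⟨N', inferInstance, inferInstance, hN'sm,
    Subalgebra.inclusion (hRA.trans (hAA'.trans hA'N')), N'.val, fun t => hN'O t.2, fun _ => rfl⟩

end Summit.ResolutionOfSingularities.ResolutionOfSingularities.Theorems.ValuativeSmoothing
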